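import Mathlib
import Literature.Probability.RandomPlanarGeometry.CurveTraversalCompact
import Literature.Probability.RandomPlanarGeometry.PolylineVertexToCurve
import Summits.CriticalPhenomena.SAWScalingLimit.Theorems.SAWDefectDecoherenceObservableToSLERGateTransferPolyline

/-!
# Averaged tightness of the carved middle pieces, helper: sub-curves of a compact family of
# curves form a relatively compact family; the middle piece of a polyline is a sub-curve

Support file for the stub `stub_midTightN` (`HexTight → MidTightN`, reshape r5 of the line
`bridge-gate-renewal`) for the crux
`Summit.CriticalPhenomena.SAWScalingLimit.Theses.SAWDefectDecoherence.ObservableToSLER`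
(item `stmt-CriticalPhenomena-14005`).  The stub re-roots the critical SAW at its first good gates
and needs the tightness of the CARVED MIDDLE curves given the tightness of the whole curves
(`HexTight`).  The one geometric input, proved here over the tree's Aizenman–Burchard kit
(`CurveTortuosity.lean`, `CurveTraversalCompact.lean`, `PolylineVertexToCurve.lean`):

* `subcurves γ` — the curves `γ ∘ φ`, `φ` a monotone time change (sub-arcs of `γ` run with any
  monotone clock); sub-curves have smaller traces and no more separate traversals of any strictly
  shrunk shell (`hasTraversals_of_mem_subcurves`, via `Curve.hasTraversals_of_weakSep`);
  `mem_subcurves_of_arc` — two monotone runs `U ∘ h`, `U ∘ h'` of a common arc with `h` continuous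
  and `range h' ⊆ [h 0, h 1]` (least-preimage clock);
* `exists_isCompact_subcurves` — for a compact set `𝒦₀` of curve classes (proper target space)
  there is a compact `𝒦` containing the class of every sub-curve of every curve whose class lies
  in `𝒦₀`: traces stay in one closed ball, and AB99 eq. (2.22) (`Curve.tortuosity_le_of_cover`)
  bounds the tortuosity of a sub-curve at every scale by the traversal thresholds of `𝒦₀`
  (`CurveClass.exists_not_hasTraversals_of_isCompact`), so AB99 Lemma 4.1
  (`CurveClass.isCompact_closure_image_mk_of_tortuosity_le`) applies;
* `exists_mem_subcurves_polyline_middle` — the polyline through `M` is, modulo reparametrisation, a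
  sub-curve of the polyline through `P ++ M ++ S` (uniform parametrisation and dyadic clock of
  `PolylineUniform.lean`, as in `GateTransferPolyline.dist_mk_polyline_append_le`);
* `exists_isCompact_polyline_middle` (registered sub-goal `stub_midTightSubarc`) — for compact `𝒦₀`
  a compact `𝒦` with `mk (polyline (P ++ M ++ S)) ∈ 𝒦₀ → mk (polyline M) ∈ 𝒦` for all lists.

Elementary real-variable topology; tagged [folklore] / AB99 §2 and Lemma 4.1.
-/

noncomputable section

open Set Metric Filter
open scoped unitInterval Topology BigOperators

namespace Summit.CriticalPhenomena.SAWScalingLimit.Theorems.ObservableToSLER.NestedGate.MidTight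

open Literature.Probability.RandomPlanarGeometry
open Literature.Probability.RandomPlanarGeometry.Polyline
open Literature.Probability.LatticeModels (polyline)
open Summit.CriticalPhenomena.SAWScalingLimit.Theorems.ObservableToSLER.BridgeGate
  (uniform_append_of_le uniform_append_of_length_le)

/-! ### Sub-curves -/

section Subcurve

variable {E : Type*} [PseudoMetricSpace E]

/-- The **sub-curves** of `γ`: the curves `γ'` with `γ' t = γ (φ t)` for a monotone time change
`φ : I → I` (not necessarily continuous, injective or onto: a sub-arc of `γ` run with an arbitrary
monotone clock, possibly resting). -/
def subcurves (γ : Curve E) : Set (Curve E) :=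
  {γ' | ∃ φ : I → I, Monotone φ ∧ ∀ t, γ' t = γ (φ t)}

/-- The trace of a sub-curve lies in the trace of the curve. -/
theorem range_subset_of_mem_subcurves {γ' γ : Curve E} (h : γ' ∈ subcurves γ) :
    γ'.range ⊆ γ.range := by
  obtain ⟨φ, -, hφ⟩ := h
  rintro _ ⟨t, rfl⟩
  exact ⟨φ t, (hφ t).symm⟩

/-- **Separate traversals of a sub-curve are separate traversals of the curve in every strictly
shrunk shell**: the traversal times of the sub-curve, pushed forward by the monotone clock, are
weakly separated traversal times of the curve (`Curve.hasTraversals_of_weakSep`). -/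
theorem hasTraversals_of_mem_subcurves {γ' γ : Curve E} (h : γ' ∈ subcurves γ) {k : ℕ} {x : E}
    {r r' R' R : ℝ} (hrr' : r < r') (hr'R' : r' < R') (hR'R : R' < R)
    (hk : γ'.HasTraversals k x r R) : γ.HasTraversals k x r' R' := by
  obtain ⟨φ, hφm, hφ⟩ := h
  obtain ⟨s, t, hst, hsep⟩ := hk
  refine Curve.hasTraversals_of_weakSep hrr' hr'R' hR'R
    ⟨φ ∘ s, φ ∘ t, fun i => ?_, fun i j hij => hφm (hsep hij).le⟩
  obtain ⟨hle, hd⟩ := hst i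
  refine ⟨hφm hle, ?_⟩
  simp only [Function.comp_apply, ← hφ]
  exact hd

/-- **Least-preimage clock.** A continuous `h : I → ℝ` has a monotone right inverse on `[h 0, h 1]`
(the least time at which a level is reached; by the intermediate value theorem it is reached). -/
theorem exists_monotone_rightInverse {h : I → ℝ} (hc : Continuous h) :
    ∃ τ : ℝ → I, Monotone τ ∧ ∀ y ∈ Icc (h 0) (h 1), h (τ y) = y := by
  classical
  refine ⟨fun y => sInf {u : I | y ≤ h u}, fun y y' hyy' => sInf_le_sInf fun u hu => hyy'.trans hu,
    fun y hy => ?_⟩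
  set A : Set I := {u | y ≤ h u} with hA
  have hA1 : (1 : I) ∈ A := hy.2
  have hAc : IsClosed A := isClosed_le continuous_const hc
  have hmem : sInf A ∈ A := hAc.csInf_mem ⟨1, hA1⟩ (OrderBot.bddBelow A)
  obtain ⟨u, hu, huy⟩ := intermediate_value_Icc (unitInterval.nonneg' : (0 : I) ≤ sInf A)
    hc.continuousOn ⟨hy.1, hmem⟩
  have huA : u ∈ A := huy.ge
  have hle : sInf A ≤ u := sInf_le huA
  have hu' : u = sInf A := le_antisymm hu.2 hle
  show h (sInf A) = y
  rw [← hu', huy]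

/-- **Two monotone runs of a common arc.** If `γ = U ∘ h` with `h` continuous and `γ' = U ∘ h'`
with `h'` monotone taking values in `[h 0, h 1]`, then `γ'` is a sub-curve of `γ` (re-time `γ'`
through the least-preimage clock of `h`). -/
theorem mem_subcurves_of_arc {γ' γ : Curve E} {U : ℝ → E} {h h' : I → ℝ} (hc : Continuous h)
    (hm' : Monotone h') (hrange : ∀ t, h' t ∈ Icc (h 0) (h 1))
    (hγ : ∀ t, γ t = U (h t)) (hγ' : ∀ t, γ' t = U (h' t)) : γ' ∈ subcurves γ := by
  obtain ⟨τ, hτm, hτ⟩ := exists_monotone_rightInverse hc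
  refine ⟨τ ∘ h', hτm.comp hm', fun t => ?_⟩
  rw [hγ', hγ, Function.comp_apply, hτ _ (hrange t)]

end Subcurve

/-! ### Sub-curves of a compact family form a relatively compact family -/

section Compact

variable {E : Type*} [PseudoMetricSpace E]

/-- The trace of a curve whose class is within `M` of the class of the constant curve at `x₀`
lies in the closed `M`-ball about `x₀`. -/
theorem range_subset_closedBall_of_dist_le {γ : Curve E} {x₀ : E} {M : ℝ}
    (h : dist (CurveClass.mk γ) (CurveClass.mk (Curve.const x₀)) ≤ M) :
    γ.range ⊆ closedBall x₀ M := by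
  rintro _ ⟨t, rfl⟩
  rw [CurveClass.dist_mk_mk] at h
  have h2 := Curve.infDist_range_le γ (Curve.const x₀) t
  have h3 : (Curve.const x₀).range = {x₀} := by
    simp only [Curve.range]
    ext z
    simp [eq_comm]
  rw [h3, Metric.infDist_singleton] at h2
  exact mem_closedBall.2 (h2.trans h)

variable [ProperSpace E]

/-- **Sub-curves of a compact family of curve classes form a relatively compact family** (proper
target space).  For compact `𝒦₀ ⊆ CurveClass E` there is a compact `𝒦` containing the class of
every sub-curve of every curve whose class lies in `𝒦₀`.  Proof: the traces lie in one closed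
ball `Λ` (compact); at scale `a = 1/(j+1)` cover `Λ` by finitely many closed `a/4`-balls and let
`k y` be a traversal threshold of `𝒦₀` for the shell `D(y; 3a/8, 5a/8)`
(`CurveClass.exists_not_hasTraversals_of_isCompact`); a sub-curve does not traverse
`D(y; a/4, 3a/4)` `k y` times (`hasTraversals_of_mem_subcurves`), so by the greedy division
(`Curve.tortuosity_le_of_cover`, AB99 eq. (2.22)) its tortuosity at scale `2a` is at most `∑ k y`;
conclude by AB99 Lemma 4.1 (`CurveClass.isCompact_closure_image_mk_of_tortuosity_le`). -/
theorem exists_isCompact_subcurves (x₀ : E) {𝒦₀ : Set (CurveClass E)} (h𝒦₀ : IsCompact 𝒦₀) :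
    ∃ 𝒦 : Set (CurveClass E), IsCompact 𝒦 ∧
      ∀ γ γ' : Curve E, CurveClass.mk γ ∈ 𝒦₀ → γ' ∈ subcurves γ → CurveClass.mk γ' ∈ 𝒦 := by
  classical
  -- the traces lie in one compact ball
  obtain ⟨M, hM⟩ := h𝒦₀.isBounded.subset_closedBall (CurveClass.mk (Curve.const x₀))
  set Λ : Set E := closedBall x₀ M with hΛdef
  have hΛ : IsCompact Λ := isCompact_closedBall x₀ M
  have hrangeΛ : ∀ γ : Curve E, CurveClass.mk γ ∈ 𝒦₀ → γ.range ⊆ Λ := fun γ hγ =>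
    range_subset_closedBall_of_dist_le (hM hγ)
  -- scales
  set a : ℕ → ℝ := fun j => 1 / ((j : ℝ) + 1) with ha_def
  have ha : ∀ j, 0 < a j := fun j => by rw [ha_def]; positivity
  -- finite nets of `Λ` at scale `a j / 4`
  have hnet : ∀ j, ∃ S : Finset E, Λ ⊆ ⋃ y ∈ S, closedBall y (a j / 4) := by
    intro j
    obtain ⟨T, -, hTfin, hTcov⟩ := finite_cover_balls_of_compact hΛ (e := a j / 4) (by
      have := ha j; positivity)
    refine ⟨hTfin.toFinset, fun z hz => ?_⟩
    obtain ⟨y, hy, hzy⟩ := mem_iUnion₂.1 (hTcov hz)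
    exact mem_iUnion₂.2 ⟨y, hTfin.mem_toFinset.2 hy, ball_subset_closedBall hzy⟩
  choose S hS using hnet
  -- traversal thresholds of `𝒦₀` for the shells `D(y; 3a/8, 5a/8)`
  have hthr : ∀ (j : ℕ) (y : E), ∃ k : ℕ, ∀ γ : Curve E, CurveClass.mk γ ∈ 𝒦₀ →
      ¬ γ.HasTraversals k y (3 * a j / 8) (5 * a j / 8) := fun j y =>
    CurveClass.exists_not_hasTraversals_of_isCompact h𝒦₀ y (by have := ha j; linarith)
  choose k hk using hthr
  set 𝒯 : Set (Curve E) :=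
    {γ | γ.range ⊆ Λ ∧ ∀ j, γ.tortuosity ((fun j => 2 * a j) j) ≤ (fun j => ∑ y ∈ S j, k j y) j}
    with h𝒯
  refine ⟨closure (CurveClass.mk '' 𝒯), ?_, ?_⟩
  · refine CurveClass.isCompact_closure_image_mk_of_tortuosity_le hΛ (fun j => 2 * a j)
      (fun j => ∑ y ∈ S j, k j y) fun η hη => ?_
    obtain ⟨j, hj⟩ := exists_nat_gt (2 / η)
    refine ⟨j, by have := ha j; positivity, ?_⟩
    have hj' : 2 / η < (j : ℝ) + 1 := hj.trans (lt_add_one _)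
    have hpos : (0 : ℝ) < (j : ℝ) + 1 := by positivity
    rw [div_lt_iff₀ hη] at hj'
    show 2 * (1 / ((j : ℝ) + 1)) ≤ η
    rw [mul_one_div, div_le_iff₀ hpos]
    linarith
  · intro γ γ' hγ hsub
    have hr : γ'.range ⊆ Λ := (range_subset_of_mem_subcurves hsub).trans (hrangeΛ γ hγ)
    refine subset_closure ⟨γ', ⟨hr, fun j => ?_⟩, rfl⟩
    refine Curve.tortuosity_le_of_cover (γ := γ') (ha j) (ρ := a j / 4) (by linarith [ha j]) (S j)
      (k j) (hr.trans (hS j)) fun y _ htr => ?_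
    refine hk j y γ hγ (hasTraversals_of_mem_subcurves hsub ?_ ?_ ?_ htr) <;> linarith [ha j]

end Compact

/-! ### The middle piece of a polyline is a sub-curve modulo reparametrisation -/

section Polyline

variable {E : Type*} [NormedAddCommGroup E] [NormedSpace ℝ E]

/-- **The polyline through `M` is, modulo reparametrisation, a sub-curve of the polyline through
`P ++ M ++ S`** (`M ≠ []`): both are uniform parametrisations run with dyadic clocks
(`Polyline.polyline_apply_eq_uniform_clock`); the uniform parametrisation of the long list on the
middle time window is that of `M`; running `M` with the clamped clock of the long list is a
monotone reparametrisation (distance `0`, `Curve.reparamDist_eq_zero_of_monotone'`) and a sub-curve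
of the long polyline (`mem_subcurves_of_arc`). -/
theorem exists_mem_subcurves_polyline_middle (P M S : List E) (hM : M ≠ []) :
    ∃ γ₃ : Curve E, CurveClass.mk γ₃ = CurveClass.mk ⟨polyline M⟩ ∧
      γ₃ ∈ subcurves ⟨polyline (P ++ M ++ S)⟩ := by
  obtain ⟨q, m, rfl⟩ := List.exists_cons_of_ne_nil hM
  set n : ℕ := m.length with hn
  set k : ℕ := P.length with hk
  -- the long list as `a :: l`, with the uniform parametrisation of `l` after time `k`
  obtain ⟨a, l, hal, hl⟩ : ∃ (a : E) (l : List E), P ++ (q :: m) ++ S = a :: l ∧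
      ∀ s : ℝ, (k : ℝ) ≤ s → uniform a l s = uniform q (m ++ S) (s - k) := by
    rcases P with _ | ⟨a, P'⟩
    · exact ⟨q, m ++ S, by simp, fun s _ => by simp [hk]⟩
    · refine ⟨a, (P' ++ [q]) ++ (m ++ S), by simp, fun s hs => ?_⟩
      have hlen : ((P' ++ [q]).length : ℝ) = k := by simp [hk]
      rw [uniform_append_of_length_le (P' ++ [q]) (m ++ S) a (by rw [hlen]; exact hs), hlen]
      congr 1
      simp
  rw [hal]
  have hlen : (l.length : ℝ) = k + n + S.length := by
    have := congrArg List.length hal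
    simp only [List.length_append, List.length_cons] at this
    have h' : l.length = k + n + S.length := by rw [hk, hn]; omega
    rw [h']; push_cast; ring
  -- the middle curve run with the clamped clock of the long list
  set V : ℝ → E := uniform q m with hV
  set h₁ : ℝ → ℝ := fun t => min (n : ℝ) (max 0 (clock l.length t - k)) with hh₁
  have hh₁c : Continuous h₁ := by
    have := continuous_clock l.length
    simp only [hh₁]
    fun_prop
  have hh₁m : Monotone h₁ := fun s t hst =>
    min_le_min_left _ (max_le_max_left _ (sub_le_sub_right (monotone_clock _ hst) _))
  let γ₃ : Curve E := ⟨⟨fun t : I => V (h₁ t), (continuous_uniform m q).comp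
    (hh₁c.comp continuous_subtype_val)⟩⟩
  have hγ₃ : ∀ t : I, γ₃ t = V (h₁ t) := fun _ => rfl
  have hS0 : (0 : ℝ) ≤ S.length := Nat.cast_nonneg _
  have hn0 : (0 : ℝ) ≤ n := Nat.cast_nonneg _
  have hk0 : (0 : ℝ) ≤ k := Nat.cast_nonneg _
  refine ⟨γ₃, ?_, ?_⟩
  · -- `γ₃` is a monotone reparametrisation of `polyline (q :: m)`
    rw [CurveClass.mk_eq_mk]
    refine Curve.reparamDist_eq_zero_of_monotone' (m := (n : ℝ)) hn0
      (V := V) (continuous_uniform m q).continuousOn hh₁c (continuous_clock n) hh₁m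
      (monotone_clock n) ?_ (clock_zero n) ?_ (clock_one n) hγ₃ ?_
    · simp [hh₁]
    · simp only [hh₁, clock_one, hlen]
      rw [max_eq_right (by linarith), min_eq_left (by linarith)]
    · intro t
      exact polyline_apply_eq_uniform_clock q m t
  · -- `γ₃` is a sub-curve of the long polyline: both run the arc `uniform a l`
    have h1range : ∀ t : I, h₁ t ∈ Icc (0 : ℝ) n := fun t =>
      ⟨le_min hn0 (le_max_left _ _), min_le_left _ _⟩
    refine mem_subcurves_of_arc (U := uniform a l) (h := fun t : I => clock l.length t)
      (h' := fun t : I => k + h₁ t) ((continuous_clock l.length).comp continuous_subtype_val)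
      (fun s t hst => add_le_add (le_refl (k : ℝ)) (hh₁m (Subtype.coe_le_coe.2 hst))) (fun t => ?_)
      (fun t => polyline_apply_eq_uniform_clock a l t) fun t => ?_
    · have := h1range t
      simp only [Set.mem_Icc, Icc.coe_zero, Icc.coe_one, clock_zero, clock_one, hlen] at this ⊢
      constructor <;> linarith [this.1, this.2]
    · rw [hγ₃, hV, hl _ (by linarith [(h1range t).1]), add_sub_cancel_left,
        uniform_append_of_le m S q (h1range t).2]

/-- **For a compact family of curve classes, the middle pieces of its polylines form a relatively
compact family**: for compact `𝒦₀` there is a compact `𝒦` with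
`mk (polyline (P ++ M ++ S)) ∈ 𝒦₀ → mk (polyline M) ∈ 𝒦` for all lists `P M S` (the class of the
junk empty polyline is added to cover `M = []`). -/
theorem exists_isCompact_polyline_middle [ProperSpace E] {𝒦₀ : Set (CurveClass E)}
    (h𝒦₀ : IsCompact 𝒦₀) :
    ∃ 𝒦 : Set (CurveClass E), IsCompact 𝒦 ∧ ∀ P M S : List E,
      CurveClass.mk ⟨polyline (P ++ M ++ S)⟩ ∈ 𝒦₀ → CurveClass.mk ⟨polyline M⟩ ∈ 𝒦 := by
  obtain ⟨𝒦, h𝒦, hsub⟩ := exists_isCompact_subcurves (0 : E) h𝒦₀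
  refine ⟨insert (CurveClass.mk ⟨polyline ([] : List E)⟩) 𝒦, h𝒦.insert _, fun P M S hPMS => ?_⟩
  rcases eq_or_ne M [] with rfl | hM
  · exact mem_insert _ _
  · obtain ⟨γ₃, h₃, hsub₃⟩ := exists_mem_subcurves_polyline_middle P M S hM
    exact mem_insert_of_mem _ (h₃ ▸ hsub _ _ hPMS hsub₃)

end Polyline

end Summit.CriticalPhenomena.SAWScalingLimit.Theorems.ObservableToSLER.NestedGate.MidTight

namespace Summit.CriticalPhenomena.SAWScalingLimit.Theorems.ObservableToSLER.NestedGate.MidTight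

/-- **Registered sub-goal `stub_midTightSubarc`** (self-contained form of
`exists_isCompact_polyline_middle`): for a compact family of curve classes in a proper real normed
space, the middle pieces of its polylines form a relatively compact family. -/
theorem stub_midTightSubarc : ∀ {E : Type*} [NormedAddCommGroup E] [NormedSpace ℝ E] [ProperSpace E] (𝒦₀ : Set (Literature.Probability.RandomPlanarGeometry.CurveClass E)), IsCompact 𝒦₀ → ∃ 𝒦 : Set (Literature.Probability.RandomPlanarGeometry.CurveClass E), IsCompact 𝒦 ∧ ∀ P M S : List E, Literature.Probability.RandomPlanarGeometry.CurveClass.mk ⟨Literature.Probability.LatticeModels.polyline (P ++ M ++ S)⟩ ∈ 𝒦₀ → Literature.Probability.RandomPlanarGeometry.CurveClass.mk ⟨Literature.Probability.LatticeModels.polyline M⟩ ∈ 𝒦 :=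
  fun _ h => exists_isCompact_polyline_middle h

end Summit.CriticalPhenomena.SAWScalingLimit.Theorems.ObservableToSLER.NestedGate.MidTight

end
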